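import Summits.ResolutionOfSingularities.ResolutionOfSingularities.Theorems.MarkedTransferCampaignW46HostLadder
import HarnessLib

/-!
# [OURS · L1 W4.6 rung (i)⁺/(ii)] THE MARKED DIMENSION LADDER — `CampaignW46.MarkedOrderReductionDimLE p d`: the host-shape rung
# `HypersurfaceOrderReductionDimLE p d` (p500045) for EVERY NON-ZERO IDEAL SHEAF (the binder `IsEffectiveCartier I` dropped),
# statement-only typing + pure-logic nesting

Everything here is OURS: one campaign DEFINITION over the W4.6 host ladder `…W46HostLadder.lean` (res-L1-type-o1 p500045:
`CampaignW46.HypersurfaceOrderReductionDimLE p d`, its `of_le`, `gammaFreeGlobalDimLE_of_host`) plus three pure-logic nesting lemmas. Nothing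
here is a statement of H. Hironaka's manuscript [Hironaka2017]; no typed candidate enters; no `Literature.…` FACT is used. Typed by res-L1-type-o1
(OURS typer o1, gen 11, 2026-08-27) on res-L1-s46-pv-1 g7's TAKING 2026-08-27T19:21:17Z «MARKED ORDER REDUCTION FOR EVERY IDEAL ON A SURFACE, WITH SNC
BOUNDARY, EVERY CHARACTERISTIC — drop the binder `IsEffectiveCartier I`» (typer's WORD 19:23:06Z: named rung). Host: MarkedTransfer
`HypersurfaceOrderReductionDimLeThree` (stmt-ResolutionOfSingularities-16156), `--supports … --as helper`; this module is ROUTE-INDEPENDENT (no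
`Theses/…` import, directly or transitively). Typer's RUNG MAP: `run/shared/lean/pub/res-hironaka/L/res-L1-type-o1/RUNG-MAP-W46.md` row (i)⁺.

WHAT IS TYPED
* `CampaignW46.MarkedOrderReductionDimLE p d` — the text of `HypersurfaceOrderReductionDimLE p d` with the single binder
  `IsEffectiveCartier I →` REMOVED: for prime `p`, every perfect field `k` of characteristic `p`, every separated, locally-of-finite-type,
  quasi-compact, integral, regular `k`-scheme `X` with `topologicalKrullDim X ≤ d`, EVERY ideal sheaf `I ≠ ⊥`, every snc boundary `E` and every
  `m ≥ 1`, the marked ideal `(I, E, m)` admits a marked resolution (`IsMarkedResolution`, BGMW Def. 3.1.3/3.1.4 shape, tree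
  `Literature.AlgebraicGeometry.Resolution.MarkedIdeals`). The perfectness / separatedness binders are KEPT verbatim from the host text so that the
  nesting below is pure logic; a prover's theorem over an arbitrary field without separatedness closes the rung by instantiation.
* `MarkedOrderReductionDimLE.of_le` — antitone in `d`.
* `hypersurfaceOrderReductionDimLE_of_marked` — the marked rung at `d` gives the host rung at `d` (specialise to effective Cartier `I`); with
  p500045's `gammaFreeGlobalDimLE_of_host`, `gammaFreeGlobalDimLE_of_marked` — and the Γ-free rung at `d`.
NAMED RUNG FOR THE PROVER (RUNG MAP (i)⁺): `markedOrderReductionDimLE_two (p) : MarkedOrderReductionDimLE p 2` — res-L1-s46-pv-1 g7 (phase 1: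
blow up the base points of the codimension-two part of `I` inside `Sing(I, m)`, termination by `(ord_x J, λ(𝒪_x/J_x))`; phase 2: the surface loop
of p557305 on the divisorial part); it re-derives the host surface rung p557305 through `hypersurfaceOrderReductionDimLE_of_marked`.

VACUITY / STRENGTH SELF-CHECK (typer). `d = 0` is the trivial slice, disclosed (an integral regular `k`-scheme of dimension `0` is the spectrum of
a field, `I ≠ ⊥` forces `I = ⊤`, `E = []` is the only snc boundary up to units, and the identity is a marked resolution) — not a named rung.
`d = 1, 2` contentful and classically true (curves: points are Cartier; surfaces: the prover's two-phase argument). `d = 3` for ARBITRARY ideal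
sheaves is conjunct-level content of the route (order reduction of every marked ideal on a regular threefold in characteristic `p`) and is NOT
claimed here. Not trivially false at any `d`. STRONGER than the host rung at the same `d` by exactly the dropped binder (lemma below).
AI-WRITTEN; NO expert review; AI review is weaker than expert review.
-/

noncomputable section

set_option linter.dupNamespace false -- mandated namespace of this single-conjunct summit

open CategoryTheory AlgebraicGeometry TopologicalSpace

namespace Summit.ResolutionOfSingularities.ResolutionOfSingularities.Theorems

namespace CampaignW46

open Literature.AlgebraicGeometry.Resolution
open Scheme.IdealSheafData

/-- [OURS · L1 W4.6 rung (i)⁺/(ii)] replaces the role of «(ii) … where MarkedTransfer `HypersurfaceOrderReductionDimLeThree` applies» read for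
EVERY non-zero ideal sheaf (not only effective Cartier ones), as a LADDER in the dimension bound `d`; NOT a statement of the manuscript: for prime
`p`, every perfect field `k` of characteristic `p`, every separated, locally-of-finite-type, quasi-compact, integral, regular `k`-scheme `X` with
`topologicalKrullDim X ≤ d`, every ideal sheaf `I ≠ 0`, every snc boundary `E` and every `m ≥ 1`, the marked ideal `(I, E, m)` admits a marked
resolution `Φ : X′ → X`, `M′` (`IsMarkedResolution`). Text = `HypersurfaceOrderReductionDimLE p d` with the binder `IsEffectiveCartier I →`
removed. [folklore] -/
def MarkedOrderReductionDimLE (p d : ℕ) : Prop :=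
  p.Prime → ∀ (k : Type) [Field k] [CharP k p] [PerfectField k] (X : AlgebraicGeometry.Scheme.{0})
    (s : X ⟶ AlgebraicGeometry.Spec (.of k)), AlgebraicGeometry.IsSeparated s → AlgebraicGeometry.LocallyOfFiniteType s →
      AlgebraicGeometry.QuasiCompact s → AlgebraicGeometry.IsIntegral X → Literature.AlgebraicGeometry.Resolution.Scheme.IsRegular X →
        topologicalKrullDim X ≤ d → ∀ (I : X.IdealSheafData), I ≠ ⊥ →
          ∀ (E : List X.IdealSheafData), Literature.AlgebraicGeometry.Resolution.HasSNC E → ∀ (m : ℕ), 1 ≤ m →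
            ∃ (X' : AlgebraicGeometry.Scheme.{0}) (Φ : X' ⟶ X) (M' : Literature.AlgebraicGeometry.Resolution.MarkedIdeal X'),
              Literature.AlgebraicGeometry.Resolution.IsMarkedResolution
                (⟨I, E, m⟩ : Literature.AlgebraicGeometry.Resolution.MarkedIdeal X) Φ M'

namespace MarkedOrderReductionDimLE

/-- Pure logic: the marked ladder is antitone in the dimension bound. [folklore] -/
theorem of_le {p d d' : ℕ} (hdd : d ≤ d') (h : MarkedOrderReductionDimLE p d') : MarkedOrderReductionDimLE p d := by
  intro hp k _ _ _ X s hsep hloft hqc hint hreg hdim I hI E hE m hm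
  exact h hp k X s hsep hloft hqc hint hreg (hdim.trans (by exact_mod_cast hdd)) I hI E hE m hm

end MarkedOrderReductionDimLE

/-- **The marked rung gives the host-shape rung at the same `d`** (forget that `I` is effective Cartier). [folklore] -/
theorem hypersurfaceOrderReductionDimLE_of_marked {p d : ℕ} (h : MarkedOrderReductionDimLE p d) :
    HypersurfaceOrderReductionDimLE p d := by
  intro hp k _ _ _ X s hsep hloft hqc hint hreg hdim I hI _ E hE m hm
  exact h hp k X s hsep hloft hqc hint hreg hdim I hI E hE m hm

/-- **… hence the Γ-free rung at the same `d`** (universe 0; through p500045's `gammaFreeGlobalDimLE_of_host`). [folklore] -/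
theorem gammaFreeGlobalDimLE_of_marked {p d : ℕ} (h : MarkedOrderReductionDimLE p d) :
    GammaFreeGlobalOrderReductionDimLE.{0} p d :=
  gammaFreeGlobalDimLE_of_host (hypersurfaceOrderReductionDimLE_of_marked h)

end CampaignW46

end Summit.ResolutionOfSingularities.ResolutionOfSingularities.Theorems

end
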